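import Summits.ValiantsHypothesis.ValiantsHypothesis.Theorems.LiftNullstellensatzLiftWidthPerFourClaimF
import Literature.Computability.AlgebraicComplexity.StandardFamilies
import Literature.RingTheory.MvPolynomial.LinearFormsCoeff

/-!
# Route LiftNullstellensatz — `LiftWidthPerFour` (item stmt-ValiantsHypothesis-5922): the
outer-layer normal form (stub `stub_outerLayers` of line `outer_layers`)

If the generic `4 × 4` permanent `per_4` lies in an ideal generated by `a ≤ 5` linear forms
`u_1, …, u_a`, then that ideal is contained in a ROW ideal `(x_{i₀ 1}, …, x_{i₀ 4}, ℓ)` or in a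
COLUMN ideal `(x_{1 j₀}, …, x_{4 j₀}, ℓ)` for one further linear form `ℓ` (possibly `0`).

Proof (folklore linear algebra around Claim F):
* the coefficient functionals `L_k : A ↦ Σ_x coeff_{x}(u_k) · A_x` on `M_4(K)` have joint
  kernel `W = ⨅ ker L_k` of dimension `≥ 16 - a ≥ 11` (rank–nullity for `A ↦ (L_k A)_k`);
* `per` vanishes on `W`: `per A = eval_A per_4`, and `eval_A` kills the ideal `(u_k)` because it
  kills its generators (`eval_A u_k = L_k A = 0`);
* Claim F (hypothesis `hF`; landed for infinite fields of characteristic `≠ 2` as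
  `linearSpace_perm4_row_or_col`) makes `W` lie in a row space `{A i₀ = 0}` or a column space;
* each coordinate functional `A ↦ A i₀ j` vanishes on `⨅ ker L_k`, so it is a combination of the
  `L_k` (Mathlib `mem_span_of_iInf_ker_le_ker`); evaluating at the elementary matrices turns
  this into `x_{i₀ j} ∈ T := span_K (u_k)`;
* `dim T ≤ a ≤ 5 = 4 + 1` and the four `x_{i₀ j}` are independent, so `T = span(x_{i₀ ·}) + K ℓ`
  for some `ℓ ∈ T` (`exists_mem_le_sup_span_singleton`), and `T` generates the ideal `(u_k)`.

Main statements: `exists_ideal_span_le_insert_of_X_mem` (the dimension step),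
`rowOrColIdeal_of_perPoly_mem_span` (any field, Claim F as hypothesis),
`stub_outerLayers` (the registered stub signature over `ℂ`, verbatim), and the unconditional
`rowOrColIdeal_of_perPoly_mem_span_of_infinite` (infinite field, `2 ≠ 0`, via the landed Claim F).
No new definitions.  VP ≠ VNP is not moved by this item (finite calibration point `n = 4`).
-/

noncomputable section

open MvPolynomial

namespace Summit.ValiantsHypothesis.LiftNullstellensatz

open Literature.Computability.AlgebraicComplexity

variable {K : Type*} [Field K]

/-- Dimension bookkeeping: if `S ≤ T` are subspaces with `dim T ≤ dim S + 1` (`T` finite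
dimensional), then `T ≤ S + K ℓ` for some `ℓ ∈ T` (take `ℓ = 0` if `T = S`, else any
`ℓ ∈ T \ S`). [folklore] -/
theorem exists_mem_le_sup_span_singleton {V : Type*} [AddCommGroup V] [Module K V]
    (S T : Submodule K V) [FiniteDimensional K T] (hST : S ≤ T)
    (hT : Module.finrank K T ≤ Module.finrank K S + 1) :
    ∃ ℓ ∈ T, T ≤ S ⊔ K ∙ ℓ := by
  by_cases h : T ≤ S
  · exact ⟨0, T.zero_mem, h.trans le_sup_left⟩
  · obtain ⟨ℓ, hℓT, hℓS⟩ := Set.not_subset.1 h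
    refine ⟨ℓ, hℓT, ?_⟩
    have hle : S ⊔ K ∙ ℓ ≤ T :=
      sup_le hST ((Submodule.span_singleton_le_iff_mem _ _).2 hℓT)
    have hlt : S < S ⊔ K ∙ ℓ := by
      refine lt_of_le_of_ne le_sup_left fun heq => hℓS ?_
      rw [heq]
      exact Submodule.mem_sup_right (Submodule.mem_span_singleton_self ℓ)
    haveI : FiniteDimensional K ↥(S ⊔ K ∙ ℓ) := Submodule.finiteDimensional_of_le hle
    have h1 : Module.finrank K S < Module.finrank K ↥(S ⊔ K ∙ ℓ) :=
      Submodule.finrank_lt_finrank_of_lt hlt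
    exact (Submodule.eq_of_le_of_finrank_le hle (by omega)).ge

/-- The dimension step of the outer-layer normal form: if `a ≤ 5` linear forms `u_k` span (over
`K`) a space containing four distinct variables `x_{v 0}, …, x_{v 3}`, then
`(u_1, …, u_a) ⊆ (x_{v 0}, …, x_{v 3}, ℓ)` for one further linear form `ℓ`. [folklore] -/
theorem exists_ideal_span_le_insert_of_X_mem {a : ℕ} (ha : a ≤ 5)
    (u : Fin a → MvPolynomial (Fin 4 × Fin 4) K) (hu : ∀ k, (u k).IsHomogeneous 1)
    (v : Fin 4 → Fin 4 × Fin 4) (hv : Function.Injective v)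
    (hX : ∀ j, (X (v j) : MvPolynomial (Fin 4 × Fin 4) K) ∈ Submodule.span K (Set.range u)) :
    ∃ ℓ : MvPolynomial (Fin 4 × Fin 4) K, ℓ.IsHomogeneous 1 ∧
      Ideal.span (Set.range u) ≤
        Ideal.span (insert ℓ (Set.range fun j => (X (v j) : MvPolynomial (Fin 4 × Fin 4) K))) := by
  classical
  set T : Submodule K (MvPolynomial (Fin 4 × Fin 4) K) := Submodule.span K (Set.range u) with hT
  set S : Submodule K (MvPolynomial (Fin 4 × Fin 4) K) :=
    Submodule.span K (Set.range fun j => (X (v j) : MvPolynomial (Fin 4 × Fin 4) K)) with hS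
  haveI : FiniteDimensional K T := FiniteDimensional.span_of_finite K (Set.finite_range u)
  have hTdim : Module.finrank K T ≤ a := by
    have := finrank_range_le_card (R := K) u
    simpa [Set.finrank] using this
  have hSdim : Module.finrank K S = 4 := by
    have hli : LinearIndependent K fun j => (X (v j) : MvPolynomial (Fin 4 × Fin 4) K) :=
      (linearIndependent_X (Fin 4 × Fin 4) K).comp v hv
    rw [hS, finrank_span_eq_card hli, Fintype.card_fin]
  have hST : S ≤ T := by
    rw [hS, Submodule.span_le]
    rintro _ ⟨j, rfl⟩
    exact hX j
  obtain ⟨ℓ, hℓT, hTle⟩ := exists_mem_le_sup_span_singleton S T hST (by omega)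
  have hThom : T ≤ homogeneousSubmodule (Fin 4 × Fin 4) K 1 := by
    rw [hT, Submodule.span_le]
    rintro _ ⟨k, rfl⟩
    exact hu k
  refine ⟨ℓ, hThom hℓT, ?_⟩
  rw [Ideal.span_le]
  rintro _ ⟨k, rfl⟩
  have hk : u k ∈ S ⊔ K ∙ ℓ := hTle (Submodule.subset_span ⟨k, rfl⟩)
  rw [hS, sup_comm, ← Submodule.span_insert] at hk
  exact Submodule.span_le_restrictScalars K (MvPolynomial (Fin 4 × Fin 4) K) _ hk

/-- **Outer-layer normal form from Claim F** (any field): if every `≥ 11`-dimensional linear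
space of `4 × 4` matrices on which `per` vanishes is a row or column space (Claim F, hypothesis
`hF`), and `per_4 ∈ (u_1, …, u_a)` for `a ≤ 5` linear forms `u_k`, then
`(u_1, …, u_a) ⊆ (x_{i₀ 1}, …, x_{i₀ 4}, ℓ)` or `⊆ (x_{1 j₀}, …, x_{4 j₀}, ℓ)` for some linear form
`ℓ`.  (Joint kernel of the coefficient functionals, `per` vanishes on it by evaluation, Claim F,
double annihilator, dimension count.) [folklore] -/
theorem rowOrColIdeal_of_perPoly_mem_span
    (hF : ∀ W : Submodule K (Matrix (Fin 4) (Fin 4) K), 11 ≤ Module.finrank K W →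
      (∀ A ∈ W, A.permanent = 0) →
      (∃ i₀ : Fin 4, ∀ A ∈ W, ∀ j, A i₀ j = 0) ∨ (∃ j₀ : Fin 4, ∀ A ∈ W, ∀ i, A i j₀ = 0))
    {a : ℕ} (ha : a ≤ 5) (u : Fin a → MvPolynomial (Fin 4 × Fin 4) K)
    (hu : ∀ k, (u k).IsHomogeneous 1) (hper : perPoly (Fin 4) K ∈ Ideal.span (Set.range u)) :
    ∃ ℓ : MvPolynomial (Fin 4 × Fin 4) K, ℓ.IsHomogeneous 1 ∧
      ((∃ i₀ : Fin 4, Ideal.span (Set.range u) ≤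
          Ideal.span (insert ℓ (Set.range fun j : Fin 4 =>
            (X (i₀, j) : MvPolynomial (Fin 4 × Fin 4) K)))) ∨
       (∃ j₀ : Fin 4, Ideal.span (Set.range u) ≤
          Ideal.span (insert ℓ (Set.range fun i : Fin 4 =>
            (X (i, j₀) : MvPolynomial (Fin 4 × Fin 4) K))))) := by
  classical
  -- coefficient vectors of the forms and the associated functionals on matrices
  set c : Fin a → Fin 4 × Fin 4 → K := fun k x => coeff (Finsupp.single x 1) (u k) with hc
  have hu_eq : ∀ k, u k = ∑ x, c k x • (X x : MvPolynomial (Fin 4 × Fin 4) K) := fun k =>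
    Literature.RingTheory.MvPolynomial.eq_sum_coeff_single_one_smul_X (hu k)
  let L : Fin a → Matrix (Fin 4) (Fin 4) K →ₗ[K] K := fun k =>
    ∑ x, c k x • Matrix.entryLinearMap K K x.1 x.2
  have hL : ∀ k A, L k A = ∑ x, c k x * A x.1 x.2 := by
    intro k A
    simp only [L, LinearMap.coe_sum, Finset.sum_apply, LinearMap.smul_apply,
      Matrix.entryLinearMap_apply, smul_eq_mul]
  have heval : ∀ k (A : Matrix (Fin 4) (Fin 4) K),
      eval (fun x : Fin 4 × Fin 4 => A x.1 x.2) (u k) = L k A := by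
    intro k A
    rw [hL, hu_eq k, map_sum]
    refine Finset.sum_congr rfl fun x _ => ?_
    rw [smul_eval, eval_X]
  have hLsingle : ∀ k (y : Fin 4 × Fin 4), L k (Matrix.single y.1 y.2 1) = c k y := by
    intro k y
    rw [hL, Finset.sum_eq_single y]
    · rw [Matrix.single_apply_same, mul_one]
    · intro x _ hne
      rw [Matrix.single_apply_of_ne, mul_zero]
      exact fun h => hne (Prod.ext h.1.symm h.2.symm)
    · exact fun h => absurd (Finset.mem_univ y) h
  -- the joint kernel `W`
  set W : Submodule K (Matrix (Fin 4) (Fin 4) K) := ⨅ k, LinearMap.ker (L k) with hW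
  have hWker : W = LinearMap.ker (LinearMap.pi L) := by rw [hW, LinearMap.ker_pi]
  have hdim : 11 ≤ Module.finrank K W := by
    have h1 := LinearMap.finrank_range_add_finrank_ker (LinearMap.pi L)
    have h2 : Module.finrank K (LinearMap.range (LinearMap.pi L)) ≤ a :=
      calc Module.finrank K (LinearMap.range (LinearMap.pi L))
          ≤ Module.finrank K (Fin a → K) := Submodule.finrank_le _
        _ = a := by simp
    have h3 : Module.finrank K (Matrix (Fin 4) (Fin 4) K) = 16 := by
      simp [Module.finrank_matrix]
    rw [hWker]
    omega
  have hmemW : ∀ A, A ∈ W ↔ ∀ k, L k A = 0 := by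
    intro A
    rw [hW, Submodule.mem_iInf]
    exact forall_congr' fun k => LinearMap.mem_ker
  -- `per` vanishes on `W`
  have hperW : ∀ A ∈ W, A.permanent = 0 := by
    intro A hA
    have hA' := (hmemW A).1 hA
    have hker : Ideal.span (Set.range u) ≤
        RingHom.ker (eval fun x : Fin 4 × Fin 4 => A x.1 x.2) := by
      rw [Ideal.span_le]
      rintro _ ⟨k, rfl⟩
      rw [SetLike.mem_coe, RingHom.mem_ker, heval, hA']
    have h0 := hker hper
    rw [RingHom.mem_ker, eval_perPoly] at h0
    exact h0
  -- double annihilator: a coordinate functional vanishing on `W` is one of the forms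
  set T : Submodule K (MvPolynomial (Fin 4 × Fin 4) K) := Submodule.span K (Set.range u) with hT
  have hXT : ∀ x : Fin 4 × Fin 4, (∀ A ∈ W, A x.1 x.2 = 0) →
      (X x : MvPolynomial (Fin 4 × Fin 4) K) ∈ T := by
    intro x hx
    have hle : ⨅ k, LinearMap.ker (L k) ≤ LinearMap.ker (Matrix.entryLinearMap K K x.1 x.2) := by
      intro A hA
      rw [LinearMap.mem_ker, Matrix.entryLinearMap_apply]
      exact hx A hA
    obtain ⟨d, hd⟩ :=
      (Submodule.mem_span_range_iff_exists_fun K).1 (mem_span_of_iInf_ker_le_ker hle)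
    -- evaluate the functional identity at the elementary matrices
    have hcoef : ∀ y : Fin 4 × Fin 4, ∑ k, d k * c k y = if x = y then 1 else 0 := by
      intro y
      have h := LinearMap.congr_fun hd (Matrix.single y.1 y.2 (1 : K))
      rw [LinearMap.coe_sum, Finset.sum_apply, Matrix.entryLinearMap_apply] at h
      simp only [LinearMap.smul_apply, smul_eq_mul, hLsingle] at h
      rw [h]
      by_cases hxy : x = y
      · subst hxy
        rw [Matrix.single_apply_same, if_pos rfl]
      · rw [Matrix.single_apply_of_ne, if_neg hxy]
        exact fun h' => hxy (Prod.ext h'.1.symm h'.2.symm)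
    have hXeq : (X x : MvPolynomial (Fin 4 × Fin 4) K) = ∑ k, d k • u k := by
      calc (X x : MvPolynomial (Fin 4 × Fin 4) K)
          = ∑ y, (if x = y then (1 : K) else 0) • (X y : MvPolynomial (Fin 4 × Fin 4) K) := by
            rw [Finset.sum_eq_single x, if_pos rfl, one_smul]
            · intro y _ hyx
              rw [if_neg (Ne.symm hyx), zero_smul]
            · exact fun h => absurd (Finset.mem_univ x) h
        _ = ∑ y, (∑ k, d k * c k y) • (X y : MvPolynomial (Fin 4 × Fin 4) K) :=
            Finset.sum_congr rfl fun y _ => by rw [hcoef]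
        _ = ∑ k, d k • u k := by
            simp_rw [Finset.sum_smul, hu_eq, Finset.smul_sum, smul_smul]
            rw [Finset.sum_comm]
    rw [hXeq]
    exact Submodule.sum_mem _ fun k _ => Submodule.smul_mem _ _ (Submodule.subset_span ⟨k, rfl⟩)
  -- Claim F and the dimension step
  rcases hF W hdim hperW with ⟨i₀, hi₀⟩ | ⟨j₀, hj₀⟩
  · obtain ⟨ℓ, hℓ, hle⟩ := exists_ideal_span_le_insert_of_X_mem ha u hu (fun j => (i₀, j))
      (fun j j' h => (Prod.mk.inj h).2) (fun j => hXT (i₀, j) fun A hA => hi₀ A hA j)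
    exact ⟨ℓ, hℓ, Or.inl ⟨i₀, hle⟩⟩
  · obtain ⟨ℓ, hℓ, hle⟩ := exists_ideal_span_le_insert_of_X_mem ha u hu (fun i => (i, j₀))
      (fun i i' h => (Prod.mk.inj h).1) (fun i => hXT (i, j₀) fun A hA => hj₀ A hA i)
    exact ⟨ℓ, hℓ, Or.inr ⟨j₀, hle⟩⟩

/-- **Stub `stub_outerLayers` of line `outer_layers`** (crux `LiftWidthPerFour`,
stmt-ValiantsHypothesis-5922), registered signature verbatim: Claim F (as a hypothesis) implies
the outer-layer normal form over `ℂ`. [folklore] -/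
theorem stub_outerLayers :
    (∀ W : Submodule ℂ (Matrix (Fin 4) (Fin 4) ℂ), 11 ≤ Module.finrank ℂ W →
      (∀ A ∈ W, A.permanent = 0) →
      (∃ i₀ : Fin 4, ∀ A ∈ W, ∀ j, A i₀ j = 0) ∨ (∃ j₀ : Fin 4, ∀ A ∈ W, ∀ i, A i j₀ = 0)) →
    ∀ a : ℕ, a ≤ 5 → ∀ u : Fin a → MvPolynomial (Fin 4 × Fin 4) ℂ,
      (∀ k, (u k).IsHomogeneous 1) → perPoly (Fin 4) ℂ ∈ Ideal.span (Set.range u) →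
      ∃ ℓ : MvPolynomial (Fin 4 × Fin 4) ℂ, ℓ.IsHomogeneous 1 ∧
        ((∃ i₀ : Fin 4, Ideal.span (Set.range u) ≤
            Ideal.span (insert ℓ (Set.range fun j : Fin 4 =>
              (X (i₀, j) : MvPolynomial (Fin 4 × Fin 4) ℂ)))) ∨
         (∃ j₀ : Fin 4, Ideal.span (Set.range u) ≤
            Ideal.span (insert ℓ (Set.range fun i : Fin 4 =>
              (X (i, j₀) : MvPolynomial (Fin 4 × Fin 4) ℂ))))) :=
  fun hF _ ha u hu hper => rowOrColIdeal_of_perPoly_mem_span hF ha u hu hper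

/-- **Outer-layer normal form, unconditional** (infinite field with `2 ≠ 0`): if
`per_4 ∈ (u_1, …, u_a)` for `a ≤ 5` linear forms, then `(u_k) ⊆ (x_{i₀ ·}, ℓ)` or
`(u_k) ⊆ (x_{· j₀}, ℓ)` for one linear form `ℓ` — Claim F is the landed
`linearSpace_perm4_row_or_col`. [folklore] -/
theorem rowOrColIdeal_of_perPoly_mem_span_of_infinite [Infinite K] (h2 : (2 : K) ≠ 0)
    {a : ℕ} (ha : a ≤ 5) (u : Fin a → MvPolynomial (Fin 4 × Fin 4) K)
    (hu : ∀ k, (u k).IsHomogeneous 1) (hper : perPoly (Fin 4) K ∈ Ideal.span (Set.range u)) :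
    ∃ ℓ : MvPolynomial (Fin 4 × Fin 4) K, ℓ.IsHomogeneous 1 ∧
      ((∃ i₀ : Fin 4, Ideal.span (Set.range u) ≤
          Ideal.span (insert ℓ (Set.range fun j : Fin 4 =>
            (X (i₀, j) : MvPolynomial (Fin 4 × Fin 4) K)))) ∨
       (∃ j₀ : Fin 4, Ideal.span (Set.range u) ≤
          Ideal.span (insert ℓ (Set.range fun i : Fin 4 =>
            (X (i, j₀) : MvPolynomial (Fin 4 × Fin 4) K))))) :=
  rowOrColIdeal_of_perPoly_mem_span (fun W hW hW' => linearSpace_perm4_row_or_col h2 W hW hW')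
    ha u hu hper

end Summit.ValiantsHypothesis.LiftNullstellensatz

end
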